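import Summits.HodgeConjecture.HodgeConjecture.Theses.Q8SymplecticPowers
import Literature.AlgebraicGeometry.HodgeTheory.MonodromyMumfordTateHeredityCurves
import Literature.AlgebraicGeometry.HodgeTheory.MumfordTateCommutatorsHodgeGroupAnyWeight
import Literature.AlgebraicGeometry.HodgeTheory.HodgeRiemannPolarizabilityProofs
import Literature.AlgebraicGeometry.HodgeTheory.BettiUniverseIsoTransport
import HarnessLib

/-!
# Route `Q8SymplecticPowers` — the PER-POINT KERNEL of crux K1Q: the `Comm` clause of
# `VeryGeneralQuaternionCommutatorsInHg` from «the quaternionic centraliser lies in the Mumford–Tate group», and from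
# «(Γ^Zar)⁰ ⊆ MT» at the point of `X` in a smooth projective family + a DENSITY hypothesis (modulo which K1Q's
# CDK-free readings are compositions with HEREDITY)

Support file for crux K1Q (stmt-HodgeConjecture-24190; `--supports … --as helper`; nothing here closes an item). Prover seat
`hodge-nonav-prover-Ax` (g16), on p3 g35's GO (o1) 2026-08-29 07:18Z. Route `Q8SymplecticPowers` (p3 g35, born 07:01Z):
`Uni X hX τ j g` := «`g ∈ GL(H²(X;ℚ))` commutes with `τ^*`, `j^*`, preserves `tr(x ∪ y)` and fixes the Hodge classes of `H²`
pointwise» (the typed quaternionic-unitary centraliser `Z(ℚ)`), `Comm X hX τ j` := «every commutator of two such `g, h` lies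
in `Hg(H²(X))(ℚ)`» — verbatim the `let`-block of the route decl.

* **`q8Comm_of_centraliser_subset_mumfordTateGroup`** (K0, pure Hodge theory): if every `g` with `Uni X hX τ j g` lies in
  `MT(H²(X))(ℚ)`, then `Comm X hX τ j` — commutators of elements of `MT(ℚ)` of a POLARIZABLE Hodge structure lie in `Hg(ℚ)`
  (`commutator_mem_hodgeGroup_of_isPolarizable`, any weight; polarizability of `H²` of a smooth projective variety is the tree
  theorem `smoothProjective_hodgeStructure_isPolarizable_holds`).
* **`q8Comm_of_glIdentityComponent_subset_mumfordTateGroup`** (K1, the per-point kernel in FAMILY currency): let `π : 𝒳 ⟶ S` be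
  ANY family, cohomologically locally trivial over `S(ℂ)` with smooth projective fibres, `t ∈ S(ℂ)` with an isomorphism
  `e : 𝒳_t ≅ X`. If (MT) `(Γ_t^Zar)⁰ ⊆ MT(H²(𝒳_t))` — the currency delivered by Deligne's lemma at Hodge-generic points and by
  HEREDITY (`glIdentityComponent_subset_mumfordTateGroup_offCountable_of_curve`, `…_offMeagre_of_baseChange`) — and (DENSITY)
  every `g` with `Uni X hX τ j g`, transported to the fibre along `e^*`, lies in `(Γ_t^Zar)⁰`, then `Comm X hX τ j`.
* **`q8Comm_offCountable_of_curve_of_density`** (K2, the (a″)-shape composition): for a smooth projective family with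
  quasi-projective total space over a smooth quasi-projective base, an algebraic one-parameter sub-family `g : P ⟶ S` through
  a point with FI, and DENSITY along it: off a COUNTABLE set of `c ∈ P(ℂ)`, `Comm` holds for every `(X, τ, j)` with `X ≅ 𝒳_{g c}`
  satisfying the density hypothesis — HEREDITY-curves ∘ K1 (unconditional).

So K1Q's CDK-free reading (a″)-C is reduced to: the Q-family (prover-Bx's `QFamily`, clauses (o)–(iii)), FI at one member,
and the DENSITY statement MON_e «the identity component of the Zariski closure of the monodromy group of the Q-family contains
the typed quaternionic centraliser of the fibre» — the geometric heart (BL_e ∕ IRR_e ∕ LOC_e, p3 Route.md r5), not touched here.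
HONEST FRAMING: pure bookkeeping (axioms standard, no named fact); DENSITY and FI are hypotheses; item 24190 OPEN; nothing here
says HC ∕ HC_CM ∕ HC_AV is proved; no ladder rung moves.

## References
* [CarlsonMullerStachPeters2017] J. Carlson, S. Müller-Stach, C. Peters, Period Mappings and Period Domains, 2nd ed., §15.2
  Lemma 15.2.7–15.2.8, §15.3 (15.7), Lemma–Def. 15.3.7, Cor. 15.3.10.
* [Deligne1980] P. Deligne, La conjecture de Weil II, Publ. Math. IHÉS 52 (1980), §4.4 (the density mechanism, not used here).
* [Deligne1972WeilK3] P. Deligne, La conjecture de Weil pour les surfaces K3, Invent. Math. 15 (1972), Prop. 7.5.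
-/

noncomputable section

set_option linter.dupNamespace false

namespace Summit.HodgeConjecture.HodgeConjecture.Theorems.Q8SymplecticPowersCommKernel

open CategoryTheory CategoryTheory.Limits
open Literature.AlgebraicGeometry.Motives Literature.AlgebraicGeometry.HodgeTheory
open Literature.AlgebraicGeometry.HodgeTheory.BettiUniverse
open Literature.AlgebraicTopology.SingularHomology

/-! ### §0 K0 — the quaternionic centraliser inside the Mumford–Tate group forces `Comm` -/

/-- **K0.** `X` a smooth projective surface, `τ j : X ⟶ X` arbitrary. If every `ℚ`-automorphism of `H²(X;ℚ)` commuting with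
`τ^*` and `j^*`, preserving `tr(x ∪ y)` and fixing the Hodge classes of `H²` pointwise lies in `MT(H²(X))(ℚ)`, then every
commutator of two such automorphisms lies in `Hg(H²(X))(ℚ)` — verbatim the `Comm X hX τ j` clause of the route decl
`Theses.Q8SymplecticPowers.VeryGeneralQuaternionCommutatorsInHg`. [cite: CarlsonMullerStachPeters2017, §15.2 Lemma 15.2.7–15.2.8 and Corollary 15.3.10] -/
theorem q8Comm_of_centraliser_subset_mumfordTateGroup ⦃X : SchemeOver ℂ⦄ (hX : IsSmoothProjective 2 X) (τ j : X ⟶ X)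
    (hMT : haveI := finite hX 2
      haveI : HodgeTensorFacts.{0, 0} := hodgeTensorFacts_holds
      ∀ g : bettiCohomology X 2 ≃ₗ[ℚ] bettiCohomology X 2,
        ((∀ x, g (pull τ 2 x) = pull τ 2 (g x)) ∧ (∀ x, g (pull j 2 x) = pull j 2 (g x)) ∧
          (∀ x y, tr hX (2 + 2) (cup X 2 2 (g x) (g y)) = tr hX (2 + 2) (cup X 2 2 x y)) ∧
          ∀ x ∈ (hodge exists_isReal_hodgeModel_holds hX 2).hodgeClasses 1, g x = x) →
        g ∈ (hodge exists_isReal_hodgeModel_holds hX 2).mumfordTateGroup) :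
    haveI := finite hX 2
    haveI : HodgeTensorFacts.{0, 0} := hodgeTensorFacts_holds
    ∀ g h : bettiCohomology X 2 ≃ₗ[ℚ] bettiCohomology X 2,
      ((∀ x, g (pull τ 2 x) = pull τ 2 (g x)) ∧ (∀ x, g (pull j 2 x) = pull j 2 (g x)) ∧
        (∀ x y, tr hX (2 + 2) (cup X 2 2 (g x) (g y)) = tr hX (2 + 2) (cup X 2 2 x y)) ∧
        ∀ x ∈ (hodge exists_isReal_hodgeModel_holds hX 2).hodgeClasses 1, g x = x) →
      ((∀ x, h (pull τ 2 x) = pull τ 2 (h x)) ∧ (∀ x, h (pull j 2 x) = pull j 2 (h x)) ∧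
        (∀ x y, tr hX (2 + 2) (cup X 2 2 (h x) (h y)) = tr hX (2 + 2) (cup X 2 2 x y)) ∧
        ∀ x ∈ (hodge exists_isReal_hodgeModel_holds hX 2).hodgeClasses 1, h x = x) →
      g * h * g⁻¹ * h⁻¹ ∈ (hodge exists_isReal_hodgeModel_holds hX 2).hodgeGroup := by
  haveI := finite hX 2
  haveI : HodgeTensorFacts.{0, 0} := hodgeTensorFacts_holds
  intro g h hg hh
  have hpol : (hodge exists_isReal_hodgeModel_holds hX 2).IsPolarizable :=
    smoothProjective_hodgeStructure_isPolarizable_holds hX _ _ 2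
  exact commutator_mem_hodgeGroup_of_isPolarizable _ hpol (hMT g hg) (hMT h hh)

/-! ### §1 K1 — the per-point kernel in family currency: `(Γ^Zar)⁰ ⊆ MT` at the point + DENSITY ⇒ `Comm` -/

/-- **K1 (the per-point kernel of K1Q, modulo DENSITY).** `π : 𝒳 ⟶ S` any family, cohomologically locally trivial over
`S(ℂ)` (`hU`), with smooth projective fibres of dimension `2` (`hsp`; Hodge-symmetric models `A`); `t ∈ S(ℂ)`; `X` a smooth
projective surface with an isomorphism `e : 𝒳_t ≅ X`; `τ j : X ⟶ X`. Hypotheses: (MT) the identity component `(Γ_t^Zar)⁰` of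
the Zariski closure of the monodromy group of `R² π_* ℚ` at `t` lies in `MT(H²(𝒳_t))(ℚ)`; (DENSITY) for every `g ∈ GL(H²(X;ℚ))`
commuting with `τ^*`, `j^*`, preserving `tr(x ∪ y)` and fixing the Hodge classes of `H²` pointwise, its transport
`(e^*) ≫ g ≫ (e^*)⁻¹` to `H²(𝒳_t;ℚ)` lies in `(Γ_t^Zar)⁰`. Conclusion: `Comm X hX τ j`.
[cite: CarlsonMullerStachPeters2017, Lemma–Definition 15.3.7 and Corollary 15.3.10] -/
theorem q8Comm_of_glIdentityComponent_subset_mumfordTateGroup {𝒳 S : SchemeOver ℂ} (π : 𝒳 ⟶ S)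
    (hU : IsCohomologicallyLocallyTrivialOn π (Set.univ : Set (ComplexPoints S)))
    (hsp : ∀ s : ComplexPoints S, IsSmoothProjective 2 (fiberOver π s))
    (A : ∀ s : ComplexPoints S, HodgeModel 2 (fiberOver π s)) (hA : ∀ s, (A s).IsHodgeSymmetric)
    (t : ComplexPoints S) ⦃X : SchemeOver ℂ⦄ (hX : IsSmoothProjective 2 X) (e : fiberOver π t ≅ X) (τ j : X ⟶ X)
    (hMT : haveI : HodgeTensorFacts.{0, 0} := hodgeTensorFacts_holds
      haveI : ∀ s : ComplexPoints S, Module.Finite ℚ (bettiCohomology (fiberOver π s) 2) := fun s => finite (hsp s) 2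
      glIdentityComponent (ratMonodromyGroup π 2 hU ⟨t, Set.mem_univ _⟩) ⊆
        (((A t).hodgeStructure (hsp t) (hA t) 2).mumfordTateGroup :
          Set (bettiCohomology (fiberOver π t) 2 ≃ₗ[ℚ] bettiCohomology (fiberOver π t) 2)))
    (hD : haveI := finite hX 2
      haveI : ∀ s : ComplexPoints S, Module.Finite ℚ (bettiCohomology (fiberOver π s) 2) := fun s => finite (hsp s) 2
      haveI : HodgeTensorFacts.{0, 0} := hodgeTensorFacts_holds
      ∀ g : bettiCohomology X 2 ≃ₗ[ℚ] bettiCohomology X 2,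
        ((∀ x, g (pull τ 2 x) = pull τ 2 (g x)) ∧ (∀ x, g (pull j 2 x) = pull j 2 (g x)) ∧
          (∀ x y, tr hX (2 + 2) (cup X 2 2 (g x) (g y)) = tr hX (2 + 2) (cup X 2 2 x y)) ∧
          ∀ x ∈ (hodge exists_isReal_hodgeModel_holds hX 2).hodgeClasses 1, g x = x) →
        (pullEquiv e 2).trans (g.trans (pullEquiv e 2).symm) ∈ glIdentityComponent (ratMonodromyGroup π 2 hU ⟨t, Set.mem_univ _⟩)) :
    haveI := finite hX 2
    haveI : HodgeTensorFacts.{0, 0} := hodgeTensorFacts_holds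
    ∀ g h : bettiCohomology X 2 ≃ₗ[ℚ] bettiCohomology X 2,
      ((∀ x, g (pull τ 2 x) = pull τ 2 (g x)) ∧ (∀ x, g (pull j 2 x) = pull j 2 (g x)) ∧
        (∀ x y, tr hX (2 + 2) (cup X 2 2 (g x) (g y)) = tr hX (2 + 2) (cup X 2 2 x y)) ∧
        ∀ x ∈ (hodge exists_isReal_hodgeModel_holds hX 2).hodgeClasses 1, g x = x) →
      ((∀ x, h (pull τ 2 x) = pull τ 2 (h x)) ∧ (∀ x, h (pull j 2 x) = pull j 2 (h x)) ∧
        (∀ x y, tr hX (2 + 2) (cup X 2 2 (h x) (h y)) = tr hX (2 + 2) (cup X 2 2 x y)) ∧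
        ∀ x ∈ (hodge exists_isReal_hodgeModel_holds hX 2).hodgeClasses 1, h x = x) →
      g * h * g⁻¹ * h⁻¹ ∈ (hodge exists_isReal_hodgeModel_holds hX 2).hodgeGroup := by
  haveI := finite hX 2
  haveI : HodgeTensorFacts.{0, 0} := hodgeTensorFacts_holds
  haveI : ∀ s : ComplexPoints S, Module.Finite ℚ (bettiCohomology (fiberOver π s) 2) := fun s => finite (hsp s) 2
  refine q8Comm_of_centraliser_subset_mumfordTateGroup hX τ j fun g hg => ?_
  -- `e^* g (e^*)⁻¹ ∈ (Γ_t^Zar)⁰ ⊆ MT(H²(𝒳_t))`, and `MT(H²(𝒳_t)) = MT((e^*)^* H²(X))`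
  have h1 := hMT (hD g hg)
  have hHS : (A t).hodgeStructure (hsp t) (hA t) 2 = (hodge exists_isReal_hodgeModel_holds hX 2).comapEquiv (pullEquiv e 2) := by
    rw [HodgeModel.hodgeStructure_eq_hodge exists_isReal_hodgeModel_holds hodgePQ_independent_of_hodgeModel_holds (hsp t) (A t) (hA t) 2]
    exact hodge_eq_comapEquiv_of_iso exists_isReal_hodgeModel_holds hodgePQ_independent_of_hodgeModel_holds (hsp t) hX e 2
  have h2 : (pullEquiv e 2).trans (g.trans (pullEquiv e 2).symm) ∈
      ((hodge exists_isReal_hodgeModel_holds hX 2).comapEquiv (pullEquiv e 2)).mumfordTateGroup := by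
    rw [← hHS]; exact h1
  rw [HodgeStructure.mem_mumfordTateGroup_comapEquiv_iff] at h2
  have hid : (pullEquiv e 2).symm.trans (((pullEquiv e 2).trans (g.trans (pullEquiv e 2).symm)).trans (pullEquiv e 2)) = g := by
    ext v; simp only [LinearEquiv.trans_apply, LinearEquiv.apply_symm_apply]
  rwa [hid] at h2

/-! ### §2 K2 — the (a″)-shape composition: HEREDITY along a curve ∘ K1 -/

/-- **K2 (reading (a″)-C modulo the Q-family and DENSITY).** `π : 𝒳 ⟶ S` a smooth projective family of surfaces with `𝒳`, `S`
quasi-projective and `S` smooth; `P` a smooth quasi-projective curve with `P(ℂ)` path connected and `g : P ⟶ S`; FI at `g c₀`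
(some finite-index subgroup of `Γ_{g c₀}` inside `MT(H²(𝒳_{g c₀}))`, models `A`). Then there is a COUNTABLE `C ⊆ P(ℂ)` such that
for every `c ∉ C`, every smooth projective surface `X ≅ 𝒳_{g c}` and every `τ j : X ⟶ X` satisfying DENSITY at `g c` (as in K1),
`Comm X hX τ j` holds. HEREDITY-curves (`glIdentityComponent_subset_mumfordTateGroup_offCountable_of_curve`, unconditional) ∘ K1.
[cite: CarlsonMullerStachPeters2017, §15.3 (15.7), Lemma–Definition 15.3.7 and Corollary 15.3.10] [cite: Deligne1972WeilK3, Prop. 7.5] -/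
theorem q8Comm_offCountable_of_curve_of_density {𝒳 S P : SchemeOver ℂ} (π : 𝒳 ⟶ S)
    (hf : IsSmoothProjectiveFamily π 2) (h𝒳 : IsQuasiProjectiveOver 𝒳) (hS : IsQuasiProjectiveOver S)
    (hSs : AlgebraicGeometry.Smooth S.hom)
    (A : ∀ s : ComplexPoints S, HodgeModel 2 (fiberOver π s)) (hA : ∀ s, (A s).IsHodgeSymmetric)
    (hPq : IsQuasiProjectiveOver P) [AlgebraicGeometry.SmoothOfRelativeDimension 1 P.hom] [PathConnectedSpace (ComplexPoints P)]
    (g : P ⟶ S) (c₀ : ComplexPoints P)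
    (hFI : haveI : HodgeTensorFacts.{0, 0} := hodgeTensorFacts_holds
      haveI : ∀ s : ComplexPoints S, Module.Finite ℚ (bettiCohomology (fiberOver π s) 2) := fun s => finite (hf.isSmoothProjective s) 2
      letI hU := isCohomologicallyLocallyTrivialOn_univ_of_isQuasiProjectiveOver π hf hS hSs
      ∃ Γ₀ : Subgroup (bettiCohomology (fiberOver π (AlgPoints.map g c₀)) 2 ≃ₗ[ℚ] bettiCohomology (fiberOver π (AlgPoints.map g c₀)) 2),
        Γ₀ ≤ ratMonodromyGroup π 2 hU ⟨AlgPoints.map g c₀, Set.mem_univ _⟩ ∧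
        (Γ₀.subgroupOf (ratMonodromyGroup π 2 hU ⟨AlgPoints.map g c₀, Set.mem_univ _⟩)).FiniteIndex ∧
        Γ₀ ≤ ((A (AlgPoints.map g c₀)).hodgeStructure (hf.isSmoothProjective (AlgPoints.map g c₀)) (hA (AlgPoints.map g c₀)) 2).mumfordTateGroup) :
    haveI : HodgeTensorFacts.{0, 0} := hodgeTensorFacts_holds
    haveI : ∀ s : ComplexPoints S, Module.Finite ℚ (bettiCohomology (fiberOver π s) 2) := fun s => finite (hf.isSmoothProjective s) 2
    letI hU := isCohomologicallyLocallyTrivialOn_univ_of_isQuasiProjectiveOver π hf hS hSs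
    ∃ C : Set (ComplexPoints P), C.Countable ∧ ∀ c : ComplexPoints P, c ∉ C →
      ∀ ⦃X : SchemeOver ℂ⦄ (hX : IsSmoothProjective 2 X) (e : fiberOver π (AlgPoints.map g c) ≅ X) (τ j : X ⟶ X),
        haveI := finite hX 2
        (∀ g' : bettiCohomology X 2 ≃ₗ[ℚ] bettiCohomology X 2,
          ((∀ x, g' (pull τ 2 x) = pull τ 2 (g' x)) ∧ (∀ x, g' (pull j 2 x) = pull j 2 (g' x)) ∧
            (∀ x y, tr hX (2 + 2) (cup X 2 2 (g' x) (g' y)) = tr hX (2 + 2) (cup X 2 2 x y)) ∧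
            ∀ x ∈ (hodge exists_isReal_hodgeModel_holds hX 2).hodgeClasses 1, g' x = x) →
          (pullEquiv e 2).trans (g'.trans (pullEquiv e 2).symm) ∈
            glIdentityComponent (ratMonodromyGroup π 2 hU ⟨AlgPoints.map g c, Set.mem_univ _⟩)) →
        ∀ g' h : bettiCohomology X 2 ≃ₗ[ℚ] bettiCohomology X 2,
          ((∀ x, g' (pull τ 2 x) = pull τ 2 (g' x)) ∧ (∀ x, g' (pull j 2 x) = pull j 2 (g' x)) ∧
            (∀ x y, tr hX (2 + 2) (cup X 2 2 (g' x) (g' y)) = tr hX (2 + 2) (cup X 2 2 x y)) ∧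
            ∀ x ∈ (hodge exists_isReal_hodgeModel_holds hX 2).hodgeClasses 1, g' x = x) →
          ((∀ x, h (pull τ 2 x) = pull τ 2 (h x)) ∧ (∀ x, h (pull j 2 x) = pull j 2 (h x)) ∧
            (∀ x y, tr hX (2 + 2) (cup X 2 2 (h x) (h y)) = tr hX (2 + 2) (cup X 2 2 x y)) ∧
            ∀ x ∈ (hodge exists_isReal_hodgeModel_holds hX 2).hodgeClasses 1, h x = x) →
          g' * h * g'⁻¹ * h⁻¹ ∈ (hodge exists_isReal_hodgeModel_holds hX 2).hodgeGroup := by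
  haveI : HodgeTensorFacts.{0, 0} := hodgeTensorFacts_holds
  haveI : ∀ s : ComplexPoints S, Module.Finite ℚ (bettiCohomology (fiberOver π s) 2) := fun s => finite (hf.isSmoothProjective s) 2
  obtain ⟨C, hCc, hC⟩ := glIdentityComponent_subset_mumfordTateGroup_offCountable_of_curve π 2 2 hf hS hSs A hA g h𝒳 hPq c₀ _ rfl hFI
  refine ⟨C, hCc, fun c hc X hX e τ j hD => ?_⟩
  exact q8Comm_of_glIdentityComponent_subset_mumfordTateGroup π _ (fun s => hf.isSmoothProjective s) A hA (AlgPoints.map g c) hX e τ j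
    (hC c hc) hD

end Summit.HodgeConjecture.HodgeConjecture.Theorems.Q8SymplecticPowersCommKernel

end
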